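import Summits.AtomisticToContinuum.HydrodynamicLimit.Theorems.MourreKoopmanChargesStressStrongMixingTorusStressTrigReduction
import HarnessLib

/-!
# `StressStrongMixing` · line `birth`, stub `stub_torusStressLongWavelength`:
# the long-wavelength glue `B3form → B3loc → B2diag₀ → B2diag`

Support file for the crux item stmt-AtomisticToContinuum-9584 (`StressStrongMixing`, route `MourreKoopmanCharges` of
`AtomisticToContinuum/HydrodynamicLimit`), line `birth` (`Cruxes/StressStrongMixing/Lines/birth.lean`), registered stub
`stub_torusStressLongWavelength` — CLOSED here (pure bookkeeping over its three hypotheses).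

With the torus two-time stress moment `M_N(s; χ₁, χ₂) := (N+1)·E_{G_N}[Π(χ₁)(Φ_{s(N+1)^{-1/3}} z)·Π(χ₂)(z)]`,
`Π(χ)(z) = (N+1)⁻¹ Σᵢ χ(xᵢ) vᵢ⁰vᵢ¹`, `G_N = localGibbsLaw σ 1 0 θ N (Φ N)`, and the pair functional
`P_N(s; f) := (N+1)·E_{G_N}[(N+1)⁻² Σ_{i,j} f(xᵢ(s_N) − xⱼ) vᵢ⁰(s_N)vᵢ¹(s_N) vⱼ⁰vⱼ¹]`, the stub says: IF
(B3form) `M_N(s; Re e_n, Re e_n) + M_N(s; Im e_n, Im e_n) = P_N(s; Re e_n)` for all `n, s, N` (`σ ≤ 1/2`), AND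
(B3loc) `P_N(s; f) − f(0)·P_N(s; 1) → 0` for continuous `f` and `s > 0` (small `σ`), AND
(B2diag₀) `M_N(s; Re e_0, Re e_0) → c_F(s)·∫(Re e_0)²` for every density-one framework `F` (small `σ`),
THEN (B2diag) `M_N(s; Re e_n, Re e_n) → c_F(s)·∫(Re e_n)²` for every `n ∈ ℤ³`, `c_F(s) = ⟪U_s ξ_Π, ξ_Π⟫_ℋ`.

Proof (`n ≠ 0`; `n = 0` is B2diag₀ itself): `Im e_0 = 0` and `Re e_0 = 1` turn B3form at wavenumber `0` into
`M_N(s; Re e_0, Re e_0) = P_N(s; 1)`, so `P_N(s; 1) → c_F(s)` (`∫(Re e_0)² = 1`); B3loc with `f = Re e_n` (`Re e_n(0) = 1`)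
gives `P_N(s; Re e_n) → c_F(s)`; B3form at `n` plus the landed isotropy `M_N(Im e_n, Im e_n) = M_N(Re e_n, Re e_n)`
(`torusStressMoment_im_im_eq_re_re`) gives `2 M_N(s; Re e_n, Re e_n) = P_N(s; Re e_n) → c_F(s)`, and `∫(Re e_n)² = 1/2`.

* `tendsto_longWavelength_glue` — the abstract real-sequence form of this bookkeeping;
* `torusStressMoment_im_im_wavenumber_zero`, `torusStressPair_re_wavenumber_zero`, `re_mFourier_apply_zero_T3`,
  `integral_re_mFourier_sq_of_ne_zero` — the four trigonometric identities used;
* `stub_torusStressLongWavelength` — the registered stub.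

References: H. Spohn, *Large Scale Dynamics of Interacting Particles* (1991), Part I §7.1 (7.6)–(7.7), (7.14)–(7.15).
-/

noncomputable section

open MeasureTheory ProbabilityTheory Filter Topology
open scoped InnerProductSpace ENNReal

namespace Summit.AtomisticToContinuum.HydrodynamicLimit.Theorems.MourreKoopmanChargesStressStrongMixing

open Literature.MathematicalPhysics.KineticTheory Literature.Analysis.FluidPDE

/-! ### The abstract bookkeeping over real sequences -/

section Glue

/-- **Long-wavelength glue, abstract form.**  Real sequences with `A + B = P` (pair form at `n`), `B = A` (isotropy),
`A₀ + B₀ = P₀` (pair form at `0`), `B₀ = 0`, `P₀ = P₁` (`Im e_0 = 0`, `Re e_0 = 1`), `P − f₀·P₁ → 0` (locality) with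
`f₀ = 1`, and `A₀ → c·I₀` with `I₀ = 1`, satisfy `A → c·I` whenever `I = 1/2`. [folklore] -/
theorem tendsto_longWavelength_glue {A B P A₀ B₀ P₀ P₁ : ℕ → ℝ} {c f₀ I₀ I : ℝ}
    (hform : ∀ N, A N + B N = P N) (hiso : ∀ N, B N = A N)
    (hform₀ : ∀ N, A₀ N + B₀ N = P₀ N) (hB₀ : ∀ N, B₀ N = 0) (hP₀ : ∀ N, P₀ N = P₁ N)
    (hloc : Tendsto (fun N => P N - f₀ * P₁ N) atTop (𝓝 0))
    (hA₀ : Tendsto A₀ atTop (𝓝 (c * I₀)))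
    (hf₀ : f₀ = 1) (hI₀ : I₀ = 1) (hI : I = 1 / 2) :
    Tendsto A atTop (𝓝 (c * I)) := by
  -- `P₁ = A₀ → c`
  have hP₁A₀ : P₁ = A₀ := funext fun N => by rw [← hP₀, ← hform₀, hB₀, add_zero]
  have hP₁ : Tendsto (fun N => f₀ * P₁ N) atTop (𝓝 c) := by
    rw [hP₁A₀, hf₀]
    have h : Tendsto A₀ atTop (𝓝 c) := by rw [hI₀, mul_one] at hA₀; exact hA₀
    exact h.congr fun N => (one_mul (A₀ N)).symm
  -- `P → c`
  have hP : Tendsto P atTop (𝓝 c) := by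
    have h := hloc.add hP₁
    rw [zero_add] at h
    exact h.congr fun N => sub_add_cancel (P N) (f₀ * P₁ N)
  -- `A = P / 2 → c / 2`
  have hA : A = fun N => P N / 2 := funext fun N => by
    have h := hform N
    rw [hiso N] at h
    linarith
  rw [hA, hI, show c * (1 / 2) = c / 2 by ring]
  exact hP.div_const 2

end Glue

/-! ### The four trigonometric identities -/

section Trig

open UnitAddTorus

/-- `M_N(s; Im e_0, Im e_0) = 0` (`Im e_0 = 0`). [folklore] -/
theorem torusStressMoment_im_im_wavenumber_zero (σ θ : ℝ)
    (Φ : (N : ℕ) → HardSphereFlow (Torus.geometry (Fin 3)) (hsDiameter σ N) (N + 1)) (s : ℝ) (N : ℕ) :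
    ((N : ℝ) + 1) * ∫ z, (∫ y, (mFourier (0 : Fin 3 → ℤ) y.1).im * (y.2 0 * y.2 1)
        ∂(empiricalMeasure ((Φ N).flow (s * ((N : ℝ) + 1) ^ (-(1 / 3 : ℝ))) z))) *
      (∫ y, (mFourier (0 : Fin 3 → ℤ) y.1).im * (y.2 0 * y.2 1) ∂(empiricalMeasure z))
      ∂(localGibbsLaw σ (fun _ => 1) (fun _ => 0) (fun _ => θ) N (Φ N)) = 0 := by
  simp only [mFourier_zero, ContinuousMap.one_apply, Complex.one_im, zero_mul, integral_zero, mul_zero]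

/-- `P_N(s; Re e_0) = P_N(s; 1)` (`Re e_0 = 1`). [folklore] -/
theorem torusStressPair_re_wavenumber_zero (σ θ : ℝ)
    (Φ : (N : ℕ) → HardSphereFlow (Torus.geometry (Fin 3)) (hsDiameter σ N) (N + 1)) (s : ℝ) (N : ℕ) :
    ((N : ℝ) + 1) * ∫ z, (∫ y, (∫ y', (mFourier (0 : Fin 3 → ℤ) (y.1 - y'.1)).re * (y.2 0 * y.2 1) * (y'.2 0 * y'.2 1)
        ∂(empiricalMeasure z)) ∂(empiricalMeasure ((Φ N).flow (s * ((N : ℝ) + 1) ^ (-(1 / 3 : ℝ))) z)))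
      ∂(localGibbsLaw σ (fun _ => 1) (fun _ => 0) (fun _ => θ) N (Φ N)) =
    ((N : ℝ) + 1) * ∫ z, (∫ y, (∫ y', 1 * (y.2 0 * y.2 1) * (y'.2 0 * y'.2 1)
        ∂(empiricalMeasure z)) ∂(empiricalMeasure ((Φ N).flow (s * ((N : ℝ) + 1) ^ (-(1 / 3 : ℝ))) z)))
      ∂(localGibbsLaw σ (fun _ => 1) (fun _ => 0) (fun _ => θ) N (Φ N)) := by
  simp only [re_mFourier_zero]

/-- `Re e_n(0) = 1`. [folklore] -/
theorem re_mFourier_apply_zero_T3 (n : Fin 3 → ℤ) : (mFourier n (0 : T3)).re = 1 := by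
  simp only [mFourier, ContinuousMap.coe_mk, Pi.zero_apply, fourier_eval_zero, Finset.prod_const_one, Complex.one_re]

/-- `∫ (Re e_n)² = 1/2` for `n ≠ 0` (global volume). [folklore] -/
theorem integral_re_mFourier_sq_of_ne_zero {n : Fin 3 → ℤ} (hn : n ≠ 0) :
    ∫ x : T3, (mFourier n x).re * (mFourier n x).re = 1 / 2 := by
  have hnn : n + n ≠ 0 := fun h => hn (by
    funext i; have := congrFun h i; simp only [Pi.add_apply, Pi.zero_apply] at this ⊢; omega)
  rw [integral_re_mul_re_mFourier, if_neg hnn, sub_self, if_pos rfl]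
  norm_num

end Trig

/-! ### The registered stub -/

section Stub

open UnitAddTorus

/-- **Stub `stub_torusStressLongWavelength` (B3lw): the long-wavelength glue**
`TorusStressPairForm → TorusStressPairLocality → TorusStressDiagonalLimitZero → TorusStressDiagonalLimit` (expanded).
With `σ₂ := min σ₂^{loc} (min σ₂^{diag₀} (1/2))`: for `n = 0` the conclusion is the third hypothesis; for `n ≠ 0` it is
`tendsto_longWavelength_glue` fed with the pair form at `n` and at `0`, the isotropy `torusStressMoment_im_im_eq_re_re`,
`Im e_0 = 0`, `Re e_0 = 1`, locality at `f = Re e_n` (`Re e_n(0) = 1`), the wavenumber-zero limit, `∫(Re e_0)² = 1` and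
`∫(Re e_n)² = 1/2`. [folklore] -/
theorem stub_torusStressLongWavelength :
    (∀ σ : ℝ, 0 < σ → σ ≤ 1 / 2 → ∀ θ : ℝ, 0 < θ →
      ∀ Φ : (N : ℕ) → HardSphereFlow (Torus.geometry (Fin 3)) (hsDiameter σ N) (N + 1),
      ∀ (n : Fin 3 → ℤ) (s : ℝ) (N : ℕ),
        ((N : ℝ) + 1) * ∫ z, (∫ y, (UnitAddTorus.mFourier n y.1).re * (y.2 0 * y.2 1)
              ∂(empiricalMeasure ((Φ N).flow (s * ((N : ℝ) + 1) ^ (-(1 / 3 : ℝ))) z))) *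
            (∫ y, (UnitAddTorus.mFourier n y.1).re * (y.2 0 * y.2 1) ∂(empiricalMeasure z))
            ∂(localGibbsLaw σ (fun _ => 1) (fun _ => 0) (fun _ => θ) N (Φ N)) +
          ((N : ℝ) + 1) * ∫ z, (∫ y, (UnitAddTorus.mFourier n y.1).im * (y.2 0 * y.2 1)
              ∂(empiricalMeasure ((Φ N).flow (s * ((N : ℝ) + 1) ^ (-(1 / 3 : ℝ))) z))) *
            (∫ y, (UnitAddTorus.mFourier n y.1).im * (y.2 0 * y.2 1) ∂(empiricalMeasure z))
            ∂(localGibbsLaw σ (fun _ => 1) (fun _ => 0) (fun _ => θ) N (Φ N)) =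
        ((N : ℝ) + 1) * ∫ z, (∫ y, (∫ y', (UnitAddTorus.mFourier n (y.1 - y'.1)).re * (y.2 0 * y.2 1) * (y'.2 0 * y'.2 1)
              ∂(empiricalMeasure z)) ∂(empiricalMeasure ((Φ N).flow (s * ((N : ℝ) + 1) ^ (-(1 / 3 : ℝ))) z)))
            ∂(localGibbsLaw σ (fun _ => 1) (fun _ => 0) (fun _ => θ) N (Φ N))) →
    (∃ σ₂ : ℝ, 0 < σ₂ ∧ ∀ σ : ℝ, 0 < σ → σ < σ₂ → ∀ θ : ℝ, 0 < θ →
      ∀ Φ : (N : ℕ) → HardSphereFlow (Torus.geometry (Fin 3)) (hsDiameter σ N) (N + 1),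
      ∀ s : ℝ, 0 < s → ∀ f : T3 → ℝ, Continuous f →
        Tendsto (fun N : ℕ =>
          ((N : ℝ) + 1) * ∫ z, (∫ y, (∫ y', f (y.1 - y'.1) * (y.2 0 * y.2 1) * (y'.2 0 * y'.2 1)
              ∂(empiricalMeasure z)) ∂(empiricalMeasure ((Φ N).flow (s * ((N : ℝ) + 1) ^ (-(1 / 3 : ℝ))) z)))
            ∂(localGibbsLaw σ (fun _ => 1) (fun _ => 0) (fun _ => θ) N (Φ N)) -
          f 0 * (((N : ℝ) + 1) * ∫ z, (∫ y, (∫ y', 1 * (y.2 0 * y.2 1) * (y'.2 0 * y'.2 1)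
              ∂(empiricalMeasure z)) ∂(empiricalMeasure ((Φ N).flow (s * ((N : ℝ) + 1) ^ (-(1 / 3 : ℝ))) z)))
            ∂(localGibbsLaw σ (fun _ => 1) (fun _ => 0) (fun _ => θ) N (Φ N)))) atTop (𝓝 0)) →
    (∃ σ₂ : ℝ, 0 < σ₂ ∧ ∀ σ : ℝ, 0 < σ → σ < σ₂ → ∀ θ : ℝ, 0 < θ → ∀ z : ℝ, 0 < z →
      ∀ F : HardSphereFluctuationData σ,
        (IsHardSphereGibbs σ z θ⁻¹ (0 : V3) F.μ ∧
          (∫ ω, cellCharge 0 ω ∂F.μ = 1) ∧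
          (∃ Φ : InfiniteHardSphereFlow (Fin 3) σ, Φ.IsEquilibriumFlow ∧ ∀ t : ℝ, F.flow t =ᵐ[F.μ] Φ.flow t) ∧
          cellObs (fun v : V3 => v 0 * v 1) ∈ F.localObs) →
        ∀ Φ : (N : ℕ) → HardSphereFlow (Torus.geometry (Fin 3)) (hsDiameter σ N) (N + 1),
        ∀ s : ℝ, 0 < s →
          Tendsto (fun N : ℕ => ((N : ℝ) + 1) * ∫ z, (∫ y, (UnitAddTorus.mFourier (0 : Fin 3 → ℤ) y.1).re * (y.2 0 * y.2 1)
              ∂(empiricalMeasure ((Φ N).flow (s * ((N : ℝ) + 1) ^ (-(1 / 3 : ℝ))) z))) *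
            (∫ y, (UnitAddTorus.mFourier (0 : Fin 3 → ℤ) y.1).re * (y.2 0 * y.2 1) ∂(empiricalMeasure z))
            ∂(localGibbsLaw σ (fun _ => 1) (fun _ => 0) (fun _ => θ) N (Φ N))) atTop
            (𝓝 (⟪F.koopman s (F.fluct (cellObs fun v : V3 => v 0 * v 1)),
                  F.fluct (cellObs fun v : V3 => v 0 * v 1)⟫_ℝ *
                ∫ x : T3, (UnitAddTorus.mFourier (0 : Fin 3 → ℤ) x).re * (UnitAddTorus.mFourier (0 : Fin 3 → ℤ) x).re))) →
    ∃ σ₂ : ℝ, 0 < σ₂ ∧ ∀ σ : ℝ, 0 < σ → σ < σ₂ → ∀ θ : ℝ, 0 < θ → ∀ z : ℝ, 0 < z →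
      ∀ F : HardSphereFluctuationData σ,
        (IsHardSphereGibbs σ z θ⁻¹ (0 : V3) F.μ ∧
          (∫ ω, cellCharge 0 ω ∂F.μ = 1) ∧
          (∃ Φ : InfiniteHardSphereFlow (Fin 3) σ, Φ.IsEquilibriumFlow ∧ ∀ t : ℝ, F.flow t =ᵐ[F.μ] Φ.flow t) ∧
          cellObs (fun v : V3 => v 0 * v 1) ∈ F.localObs) →
        ∀ Φ : (N : ℕ) → HardSphereFlow (Torus.geometry (Fin 3)) (hsDiameter σ N) (N + 1),
        ∀ n : Fin 3 → ℤ, ∀ s : ℝ, 0 < s →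
          Tendsto (fun N : ℕ => ((N : ℝ) + 1) * ∫ z, (∫ y, (UnitAddTorus.mFourier n y.1).re * (y.2 0 * y.2 1)
              ∂(empiricalMeasure ((Φ N).flow (s * ((N : ℝ) + 1) ^ (-(1 / 3 : ℝ))) z))) *
            (∫ y, (UnitAddTorus.mFourier n y.1).re * (y.2 0 * y.2 1) ∂(empiricalMeasure z))
            ∂(localGibbsLaw σ (fun _ => 1) (fun _ => 0) (fun _ => θ) N (Φ N))) atTop
            (𝓝 (⟪F.koopman s (F.fluct (cellObs fun v : V3 => v 0 * v 1)),
                  F.fluct (cellObs fun v : V3 => v 0 * v 1)⟫_ℝ *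
                ∫ x : T3, (UnitAddTorus.mFourier n x).re * (UnitAddTorus.mFourier n x).re)) := by
  intro hForm hLoc hDiag₀
  obtain ⟨σL, hσL, HL⟩ := hLoc
  obtain ⟨σD, hσD, HD⟩ := hDiag₀
  refine ⟨min σL (min σD (1 / 2)), lt_min hσL (lt_min hσD (by norm_num)), ?_⟩
  intro σ hσ hσlt θ hθ z hz F hF Φ n s hs
  have hL : σ < σL := lt_of_lt_of_le hσlt (min_le_left _ _)
  have hDh : σ < min σD (1 / 2) := lt_of_lt_of_le hσlt (min_le_right _ _)
  have hD : σ < σD := lt_of_lt_of_le hDh (min_le_left _ _)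
  have hhalf : σ ≤ 1 / 2 := (lt_of_lt_of_le hDh (min_le_right _ _)).le
  have h₀ := HD σ hσ hD θ hθ z hz F hF Φ s hs
  by_cases hn : n = 0
  · subst hn
    exact h₀
  have hloc := HL σ hσ hL θ hθ Φ s hs (fun x : T3 => (mFourier n x).re) (continuous_re_mFourier n)
  beta_reduce at hloc
  exact tendsto_longWavelength_glue (fun N => hForm σ hσ hhalf θ hθ Φ n s N)
    (fun N => torusStressMoment_im_im_eq_re_re hhalf hθ Φ hn s N) (fun N => hForm σ hσ hhalf θ hθ Φ 0 s N)
    (fun N => torusStressMoment_im_im_wavenumber_zero σ θ Φ s N) (fun N => torusStressPair_re_wavenumber_zero σ θ Φ s N)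
    hloc h₀ (re_mFourier_apply_zero_T3 n) integral_re_mFourier_zero_sq (integral_re_mFourier_sq_of_ne_zero hn)

end Stub

end Summit.AtomisticToContinuum.HydrodynamicLimit.Theorems.MourreKoopmanChargesStressStrongMixing

end
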